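import Mathlib
import HarnessLib
import Summits.HubbardSuperconductivity.HubbardSuperconductivity.Theorems.KLProgrammeKLRegimeCountertermJacksonRemainderStructured

/-!
# Route `KLProgramme`, crux K3 — gen-8 ENGINE-FLOW child (stmt-HubbardSuperconductivity-20437 `KLRegimeEngineV17F2`), stub (C)
# `stub_twoLeg_curvature`: the (C1) JACKSON-REMAINDER DOOR v2, part 2b — LOCAL and ALMOST-EVERYWHERE forms of the structured bound

Seat hubbard-kl-k3c3-p1 (g6).  Part 2 (`…JacksonRemainderStructured`) asks the displaced angular factor `A∘(γ − v)` to be `C⁴` on the whole line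
and the majorant properties for EVERY displacement of the (sub-)square.  The bundle's own angular factor `(f − mean f)∘polarAngle∘centredRep` is
`C⁴` only off the origin and off the cell-boundary lines — i.e. near `θ` along `γ − v_w` for every `w` off a NULL set — which is all the smoothing
integral needs.  This file records the corresponding forms (evidence #38 `C1-CUTOFF-DEFECT-MOMENTS.md` §3–§4: the certificate integrates over the
WHOLE square, no far sup-term):
* `iteratedDeriv_displacedDiff_eq_structured_of_contDiffAt`, `abs_iteratedDeriv_displacedDiff_le_structured_of_contDiffAt` (Leibniz WITHIN an open
  neighbourhood of `θ`, `norm_iteratedFDerivWithin_mul_le` + `iteratedFDerivWithin_of_isOpen`);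
* `abs_iteratedDeriv_jhigh1_comp_curve_le_integral_ae` (majorant a.e.), **`abs_iteratedDeriv_jhigh1_comp_curve_le_mixedMoments_ae`**
  (`|∂ᵏ[(F − 𝒥_dF)∘ofLp∘γ](θ)| ≤ Σ_{i≤k} C(k,i)·Mx i + Tm` from a.e.-in-`w` hypotheses on the whole square).
Pure real analysis; no definitions; nothing about the model; nothing here asserts superconductivity.
-/

noncomputable section

namespace Summit.HubbardSuperconductivity.HubbardSuperconductivity.Theorems.KLRegimeSplit

set_option linter.dupNamespace false -- summit = problem name (single-conjunct summit), D-0017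

open Real MeasureTheory Filter Metric Function
open scoped Topology ContDiff
open Literature.Analysis.Fourier.TrigApprox Literature.MathematicalPhysics.QuantumLattice

/-! ## §1 The pointwise bound with the angular factor `C⁴` at `θ` only -/

section Local

variable {G χ A : EuclideanSpace ℝ (Fin 2) → ℝ} {m : ℝ} {γ : ℝ → EuclideanSpace ℝ (Fin 2)} {v : EuclideanSpace ℝ (Fin 2)} {θ : ℝ}

/-- The structure identity of §1 with the displaced angular factor only `C⁴` AT `θ`. -/
theorem iteratedDeriv_displacedDiff_eq_structured_of_contDiffAt (hGdec : ∀ q, G q = m + χ q * A q) (hflat : ∀ ϑ : ℝ, χ (γ ϑ) = 1)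
    (hcv : ContDiff ℝ 4 (fun ϑ : ℝ => χ (γ ϑ - v))) (hAv : ContDiffAt ℝ 4 (fun ϑ : ℝ => A (γ ϑ - v)) θ) {k : ℕ} (hk : k ≤ 4) :
    iteratedDeriv k (fun ϑ : ℝ => G (γ ϑ - v)) θ - iteratedDeriv k (fun ϑ : ℝ => G (γ ϑ)) θ =
      iteratedDeriv k (fun ϑ : ℝ => (χ (γ ϑ - v) - 1) * A (γ ϑ - v)) θ +
        (iteratedDeriv k (fun ϑ : ℝ => A (γ ϑ - v)) θ - iteratedDeriv k (fun ϑ : ℝ => A (γ ϑ)) θ) := by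
  have hk' : (k : WithTop ℕ∞) ≤ 4 := by exact_mod_cast hk
  have hP : ContDiffAt ℝ 4 (fun ϑ : ℝ => (χ (γ ϑ - v) - 1) * A (γ ϑ - v)) θ := (hcv.contDiffAt.sub contDiffAt_const).mul hAv
  have ev : (fun ϑ : ℝ => G (γ ϑ - v)) = fun ϑ : ℝ => m + ((fun ϑ : ℝ => (χ (γ ϑ - v) - 1) * A (γ ϑ - v)) + fun ϑ : ℝ => A (γ ϑ - v)) ϑ := by
    funext ϑ; simp only [Pi.add_apply, hGdec]; ring
  have e0 : (fun ϑ : ℝ => G (γ ϑ)) = fun ϑ : ℝ => m + A (γ ϑ) := by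
    funext ϑ; rw [hGdec, hflat ϑ, one_mul]
  rw [ev, e0]
  rcases Nat.eq_zero_or_pos k with rfl | hk0
  · simp only [iteratedDeriv_zero, Pi.add_apply]; ring
  · rw [iteratedDeriv_const_add hk0, iteratedDeriv_const_add hk0, iteratedDeriv_add (hP.of_le hk') (hAv.of_le hk')]
    ring

/-- **The pointwise structured bound with the displaced angular factor only `C⁴` at `θ`** (same conclusion as §1). -/
theorem abs_iteratedDeriv_displacedDiff_le_structured_of_contDiffAt (hGdec : ∀ q, G q = m + χ q * A q) (hflat : ∀ ϑ : ℝ, χ (γ ϑ) = 1)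
    (hcv : ContDiff ℝ 4 (fun ϑ : ℝ => χ (γ ϑ - v))) (hAv : ContDiffAt ℝ 4 (fun ϑ : ℝ => A (γ ϑ - v)) θ) {k : ℕ} (hk : k ≤ 4)
    {c a : ℕ → ℝ} (hc : ∀ i ≤ k, |iteratedDeriv i (fun ϑ : ℝ => χ (γ ϑ - v) - 1) θ| ≤ c i)
    (ha : ∀ j ≤ k, |iteratedDeriv j (fun ϑ : ℝ => A (γ ϑ - v)) θ| ≤ a j) {t : ℝ}
    (ht : |iteratedDeriv k (fun ϑ : ℝ => A (γ ϑ - v)) θ - iteratedDeriv k (fun ϑ : ℝ => A (γ ϑ)) θ| ≤ t) :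
    |iteratedDeriv k (fun ϑ : ℝ => G (γ ϑ - v)) θ - iteratedDeriv k (fun ϑ : ℝ => G (γ ϑ)) θ| ≤
      (∑ i ∈ Finset.range (k + 1), (k.choose i : ℝ) * c i * a (k - i)) + t := by
  have hk' : (k : WithTop ℕ∞) ≤ 4 := by exact_mod_cast hk
  -- a neighbourhood of `θ` on which the displaced angular factor is `C⁴`
  obtain ⟨u, u_open, hθu, hu⟩ := hAv.contDiffOn' le_rfl (by simp)
  have hu' : ContDiffOn ℝ 4 (fun ϑ : ℝ => A (γ ϑ - v)) u := by
    refine hu.mono fun x hx => ?_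
    exact ⟨Set.mem_insert_of_mem _ (Set.mem_univ _), hx⟩
  have hcu : ContDiffOn ℝ 4 (fun ϑ : ℝ => χ (γ ϑ - v) - 1) u := (hcv.sub contDiff_const).contDiffOn
  rw [iteratedDeriv_displacedDiff_eq_structured_of_contDiffAt hGdec hflat hcv hAv hk]
  refine (abs_add_le _ _).trans (add_le_add ?_ ht)
  rw [abs_iteratedDeriv_eq_norm_iteratedFDeriv, ← iteratedFDerivWithin_of_isOpen k u_open hθu]
  refine (norm_iteratedFDerivWithin_mul_le hcu hu' u_open.uniqueDiffOn hθu hk').trans (Finset.sum_le_sum fun i hi => ?_)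
  have hik : i ≤ k := Nat.lt_succ_iff.mp (Finset.mem_range.mp hi)
  rw [iteratedFDerivWithin_of_isOpen i u_open hθu, iteratedFDerivWithin_of_isOpen (k - i) u_open hθu,
    ← abs_iteratedDeriv_eq_norm_iteratedFDeriv, ← abs_iteratedDeriv_eq_norm_iteratedFDeriv]
  have h1 := hc i hik
  have h2 := ha (k - i) (Nat.sub_le k i)
  exact mul_le_mul (mul_le_mul_of_nonneg_left h1 (by positivity)) h2 (abs_nonneg _) ((abs_nonneg _).trans h1 |> fun h => by positivity)

end Local

/-! ## §2 Almost-everywhere hypotheses over the whole smoothing square -/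

section MixedAE

variable (d : ℕ) {F : (Fin 2 → ℝ) → ℝ} {χ A : EuclideanSpace ℝ (Fin 2) → ℝ} {m : ℝ} {γ : ℝ → EuclideanSpace ℝ (Fin 2)}

/-- The majorant form of part 1 with the majorant property only ALMOST EVERYWHERE on the smoothing square. -/
theorem abs_iteratedDeriv_jhigh1_comp_curve_le_integral_ae (hF : Continuous F)
    (hG : ContDiff ℝ 4 (fun q : EuclideanSpace ℝ (Fin 2) => F (WithLp.ofLp q))) (hγ : ContDiff ℝ 4 γ) {k : ℕ} (hk : k ≤ 4) (θ : ℝ)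
    {maj : ℝ × ℝ → ℝ} (hint : Integrable (fun w => jweight d w * maj w) jmeas)
    (hmaj : ∀ᵐ w ∂jmeas,
      |iteratedDeriv k (fun ϑ : ℝ => F (WithLp.ofLp (γ ϑ - jshift w))) θ - iteratedDeriv k (fun ϑ : ℝ => F (WithLp.ofLp (γ ϑ))) θ| ≤ maj w) :
    |iteratedDeriv k ((fun q : EuclideanSpace ℝ (Fin 2) => jhigh1 d F (WithLp.ofLp q)) ∘ γ) θ| ≤ ∫ w, jweight d w * maj w ∂jmeas := by
  rw [iteratedDeriv_jhigh1_comp_curve_eq' d hF hG hγ hk θ, abs_neg, ← Real.norm_eq_abs]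
  refine norm_integral_le_of_norm_le hint (hmaj.mono fun w hw => ?_)
  rw [Real.norm_eq_abs, abs_mul, abs_of_nonneg (jweight_nonneg d w)]
  exact mul_le_mul_of_nonneg_left hw (jweight_nonneg d w)

/-- **THE (C1) DOOR v2 IN MIXED-MOMENT FORM, WHOLE SQUARE, A.E. HYPOTHESES** (the certificate's form with the bundle's own angular factor, which is
`C⁴` near `θ` along the displaced curve for every displacement off a null set): `F∘ofLp = m + χ·A`, `χ∘γ ≡ 1`, `χ ∈ C⁴`; for a.e. `w` in the smoothing
square, `A∘(γ − v_w)` is `C⁴` at `θ` and the three majorant properties hold there (continuous majorants `cdef i`, `adef j`, `tdef`); mixed moments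
`∫J̃J̃·cdef i·adef (k−i) ≤ Mx i`, `∫J̃J̃·tdef ≤ Tm`.  Then `|∂ᵏ[(F − 𝒥_dF)∘ofLp∘γ](θ)| ≤ Σ_{i≤k} C(k,i)·Mx i + Tm` (`k ≤ 4`). -/
theorem abs_iteratedDeriv_jhigh1_comp_curve_le_mixedMoments_ae (hF : Continuous F)
    (hG : ContDiff ℝ 4 (fun q : EuclideanSpace ℝ (Fin 2) => F (WithLp.ofLp q))) (hγ : ContDiff ℝ 4 γ) {k : ℕ} (hk : k ≤ 4) (θ : ℝ)
    (hGdec : ∀ q, F (WithLp.ofLp q) = m + χ q * A q) (hflat : ∀ ϑ : ℝ, χ (γ ϑ) = 1) (hχ : ContDiff ℝ 4 χ)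
    {cdef adef : ℕ → ℝ × ℝ → ℝ} (hcdef_cont : ∀ i ≤ k, Continuous (cdef i)) (hadef_cont : ∀ j ≤ k, Continuous (adef j))
    {tdef : ℝ × ℝ → ℝ} (htdef_cont : Continuous tdef)
    (hw : ∀ᵐ w ∂jmeas, ContDiffAt ℝ 4 (fun ϑ : ℝ => A (γ ϑ - jshift w)) θ ∧
      (∀ i ≤ k, |iteratedDeriv i (fun ϑ : ℝ => χ (γ ϑ - jshift w) - 1) θ| ≤ cdef i w) ∧
      (∀ j ≤ k, |iteratedDeriv j (fun ϑ : ℝ => A (γ ϑ - jshift w)) θ| ≤ adef j w) ∧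
      |iteratedDeriv k (fun ϑ : ℝ => A (γ ϑ - jshift w)) θ - iteratedDeriv k (fun ϑ : ℝ => A (γ ϑ)) θ| ≤ tdef w)
    {Mx : ℕ → ℝ} (hMx : ∀ i ≤ k, ∫ w, jweight d w * (cdef i w * adef (k - i) w) ∂jmeas ≤ Mx i)
    {Tm : ℝ} (hTm : ∫ w, jweight d w * tdef w ∂jmeas ≤ Tm) :
    |iteratedDeriv k ((fun q : EuclideanSpace ℝ (Fin 2) => jhigh1 d F (WithLp.ofLp q)) ∘ γ) θ| ≤
      (∑ i ∈ Finset.range (k + 1), (k.choose i : ℝ) * Mx i) + Tm := by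
  set P : ℝ × ℝ → ℝ := fun w => (∑ i ∈ Finset.range (k + 1), (k.choose i : ℝ) * cdef i w * adef (k - i) w) + tdef w with hP
  have hPc : Continuous P := (continuous_finsetSum _ fun i hi => by
    have hik : i ≤ k := Nat.lt_succ_iff.mp (Finset.mem_range.mp hi)
    exact (continuous_const.mul (hcdef_cont i hik)).mul (hadef_cont _ (Nat.sub_le k i))).add htdef_cont
  have iP : Integrable (fun w : ℝ × ℝ => jweight d w * P w) jmeas := integrable_jmeas_of_continuous ((continuous_jweight d).mul hPc)
  have hM : ∀ᵐ w ∂jmeas,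
      |iteratedDeriv k (fun ϑ : ℝ => F (WithLp.ofLp (γ ϑ - jshift w))) θ - iteratedDeriv k (fun ϑ : ℝ => F (WithLp.ofLp (γ ϑ))) θ| ≤ P w := by
    refine hw.mono fun w hw => ?_
    obtain ⟨hAv, hc, ha, ht⟩ := hw
    have hcv : ContDiff ℝ 4 (fun ϑ : ℝ => χ (γ ϑ - jshift w)) := hχ.comp (hγ.sub contDiff_const)
    exact abs_iteratedDeriv_displacedDiff_le_structured_of_contDiffAt (G := fun q : EuclideanSpace ℝ (Fin 2) => F (WithLp.ofLp q)) hGdec hflat hcv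
      hAv hk (c := fun i => cdef i w) (a := fun j => adef j w) hc ha ht
  refine (abs_iteratedDeriv_jhigh1_comp_curve_le_integral_ae d hF hG hγ hk θ iP hM).trans ?_
  have eP : (fun w => jweight d w * P w) =
      fun w => (∑ i ∈ Finset.range (k + 1), (k.choose i : ℝ) * (jweight d w * (cdef i w * adef (k - i) w))) + jweight d w * tdef w := by
    funext w; simp only [hP, mul_add, Finset.mul_sum]; congr 1; refine Finset.sum_congr rfl fun i _ => ?_; ring
  have ii : ∀ i ∈ Finset.range (k + 1), Integrable (fun w => (k.choose i : ℝ) * (jweight d w * (cdef i w * adef (k - i) w))) jmeas := by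
    intro i hi
    have hik : i ≤ k := Nat.lt_succ_iff.mp (Finset.mem_range.mp hi)
    exact (integrable_jmeas_of_continuous ((continuous_jweight d).mul ((hcdef_cont i hik).mul (hadef_cont _ (Nat.sub_le k i))))).const_mul _
  have iS1 : Integrable (fun w => ∑ i ∈ Finset.range (k + 1), (k.choose i : ℝ) * (jweight d w * (cdef i w * adef (k - i) w))) jmeas :=
    integrable_finsetSum _ ii
  have iT : Integrable (fun w => jweight d w * tdef w) jmeas := integrable_jmeas_of_continuous ((continuous_jweight d).mul htdef_cont)
  rw [eP, integral_add iS1 iT, integral_finsetSum _ ii]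
  refine add_le_add (Finset.sum_le_sum fun i hi => ?_) hTm
  have hik : i ≤ k := Nat.lt_succ_iff.mp (Finset.mem_range.mp hi)
  rw [integral_const_mul]
  exact mul_le_mul_of_nonneg_left (hMx i hik) (by positivity)

end MixedAE

end Summit.HubbardSuperconductivity.HubbardSuperconductivity.Theorems.KLRegimeSplit

end
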